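import Literature.MathematicalPhysics.QuantumFieldTheory.Balaban1983to89.B10Eq61GaussianLogarithm
import Literature.MathematicalPhysics.QuantumFieldTheory.Balaban1983to89.B1Eq324BenfattoClassSectEMember
import Literature.MathematicalPhysics.QuantumFieldTheory.GaussianToolkit
import Literature.MathematicalPhysics.QuantumFieldTheory.CurvatureGaussianField
import HarnessLib

/-!
# `Balaban1983to89.B10Eq55GaussianStepPresentation` — the fluctuation measure `dμ_{C^{(k)}(B(Λ_{k+1}),U_{k+1})}` of
# [Balaban1985UV3] (55)∕(58) as typed by cell lit-balaban (`B10Eq55GaussianStep.gaussMeasure μ Δ = Z⁻¹·exp[−½⟨A,Δ_kA⟩]dμ`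
# on the abstract space of independent variables `Ã`, [Balaban1985BackgroundPropagators] (3.155) at `g = 0`) IS, in any
# basis, THE CENTRED GAUSSIAN FIELD of the n08 class road with covariance the inverse matrix of the form; and
# [Balaban1982Higgs1] (3.24) for it on a labelled torus block at every coupling `η ∈ (0,1]` (seat dag-n08-b gen 15, CLAIM-2)

statement-level companion of a published source with citation tags; every declaration here is a theorem; nothing here is
a claim about the Yang–Mills mass gap

THE PRINTED LOCUS.  [Balaban1985UV3] (= [B10]) p. 269, (55): *"(The integral (49)) ≤ χ_{k+1} exp[⋯ + log Z^{(k)}(B(Λ_{k+1}),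
U_{k+1})] × ∫dμ_{C^{(k)}(B(Λ_{k+1}),U_{k+1})}(A) χ exp[𝓋(g_kA) − (1/g_k²)Ṽ(g_kA) + ⋯]"*; p. 270, (58): *"∫dμ_{C^{(k)}}(A)χ exp[𝒱(A)
+ O((L^kε)^{3+κ₀})|T₁^{(k)}|]; cumulant expansion to 6th order"* (node N08's row `h324c` = [Balaban1982Higgs1] (3.24) for this integral);
p. 271: *"We eliminate the δ-functions and we write the integral in terms of the independent variables Ã introduced at the beginning of
Sect. E [5]. They are connected with A by the simple linear operator C described there, A = CÃ, and we obtain the Gaussian integral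
determined by the positive quadratic form ⟨A, C*Δ_kCA⟩."*  [Balaban1985BackgroundPropagators] (= [5]) p. 427, (3.155):
*"e^{½⟨g, C^{(k)}(Λ)g⟩} = (Z^{(k)}(Λ))^{−1}∫dB↾_Λ δ(Q₁B)δ_{Ax}(B)·exp[−½⟨H₁B, G₁^{−1}H₁B⟩ + ½a⟨B,B⟩ + ⟨H₁D̃^{(2)}(B), J⟩ + ⟨B, g⟩]"*,
p. 428, (3.157)–(3.158): *"C^{(k)}(Λ) = C(C*Δ_kC)^{−1}C*, or (C*Δ_kC)^{−1} = C̃^{(k)}(Λ) = C^{(k)}(Λ)↾_Λ̃"*.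

WHY THIS MODULE (cell `pub-ymgap`, seat `dag-n08-b` gen 15, CLAIM-2; node N08 [Balaban1985UV3]).  Cell lit-balaban (seat r07, rows B10.Eq55 ∕
B10.Eq61) typed the objects of the sentence above: `B10Eq55GaussianStep.Zk μ Δ` (= `Z^{(k)}`), `B10Eq55GaussianStep.gaussMeasure μ Δ` (= `dμ_{C^{(k)}}`) on
an ABSTRACT finite-dimensional space `S` of independent variables with ANY Lebesgue normalisation `μ`, and in `B10Eq61GaussianLogarithm` the coordinates
of a basis `b` («we write the integral in terms of the independent variables Ã»: `apply_equivFun_symm`, `exists_map_equivFunL_eq_smul`).  The n08 class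
road proves (3.24) for the CENTRED GAUSSIAN FIELD `gaussianFieldOfKernel K` (`CurvatureGaussianField`) of a class member (seat n08-b's
`…ClassSectEMember.eq324_torus_of_expDecay_on_unit`), and seat n08-w4's (α)-socket consumes an a.e. PRESENTATION `μ_step = (gaussianFieldOfKernel K).map Φ`.
THIS FILE is the measure-generic junction: lit-balaban's `dμ_{C^{(k)}}` IS such a presentation, in every basis, with `K` the inverse of the matrix of
`Δ`; whence (3.24) for lit-balaban's measure whenever that matrix — «⟨Ã, C*Δ_kCÃ⟩ in coordinates» — has the member rows (n08-b p645440's letters).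

WHAT IS PROVED (standard axioms; no `sorry`; no definition).
* §1 ★★ `gaussianFieldOfKernel_eq_map_multivariateGaussian` — on a FINITE index type, the Gaussian field of a positive semidefinite matrix kernel IS
  Mathlib's `multivariateGaussian 0 S` read on `ι → ℝ` (the tree's uniqueness theorem `eq_gaussianFieldOfKernel_of_isGaussianProcess`: the coordinate
  process is Gaussian, centred, with covariance `S i j` — Mathlib `covariance_eval_multivariateGaussian`); `isPosSemidefKernel_of_posSemidef`.
* §2 ★★ `gaussMeasure_volume_eq_gaussianFieldOfKernel` — on `ι → ℝ` with Lebesgue `volume` and a positive definite `P`: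
  `gaussMeasure volume ⟨·,P·⟩ = gaussianFieldOfKernel (P⁻¹)` (`GaussianToolkit.multivariateGaussian_inv_eq_withDensity` transported by
  `EuclideanSpace.volume_preserving_symm_measurableEquiv_toLp`; two probability measures with proportional densities coincide).
* §3 `gaussMeasure_map_equivFun` (coordinates transport `dμ_{C^{(k)}}` to the `gaussMeasure` of the matrix form, any normalisation),
  ★★★ `gaussMeasure_map_equivFun_eq_gaussianFieldOfKernel` (`(dμ_{C^{(k)}}).map b.equivFun = gaussianFieldOfKernel (M⁻¹)`, `M = LinearMap.toMatrix₂ b b Δ`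
  positive definite — lit-balaban's normalisation independence `gaussMeasure_smul_measure` + §2), ★★★ `gaussMeasure_eq_map_gaussianFieldOfKernel` (the
  presentation form `dμ_{C^{(k)}} = (gaussianFieldOfKernel (M⁻¹)).map b.equivFun.symm` = the (α)-socket's `hμ` letter for this measure),
  `preimage_box_eq` (its `hbox` letter: coordinate boxes pull back to coordinate boxes), `posDef_toMatrix₂_of_coercive` (the class member shape ⇒ `M` positive definite).
* §4 ★★★ `eq324_gaussMeasure_torus_on_unit` — for lit-balaban's measure whose form has, in a basis indexed by torus-labelled variables, a symmetric
  `γ`-coercive matrix decaying along a `ρ` dominating the torus sup-distance: a window `Λ ⊂ ℤ^{2d+1}`, `e : β ≃ ↥Λ`, the PRESENTATION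
  `dμ_{C^{(k)}} = (μ_K).map (b.equivFun.symm ∘ (z ↦ z ∘ e))`, the a.e. identity of the coordinate boxes, and the (3.24) pair at every `η ∈ (0,1]` — ONE
  obtain over seat n08-b's `eq324_torus_of_expDecay_on_unit` (class scalars first; `S, μ, b, β` inside the ∀).
HONEST SCOPE.  Count-neutral measure-generic bookkeeping composing LANDED theorems of this cell, of cell lit-balaban and of Mathlib BY NAME.  Lit-balaban's
`S`, `μ`, `Δ` are ABSTRACT: the reading «`S = 𝔤^{Λ̃}`, `Δ = ⟨Ã, C*Δ_kCÃ⟩`, coordinates = the bond variables `Ã(b)` of `Λ̃` times a basis of `𝔤`» is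
lit-balaban's DICTIONARY, not an object of this cell's NODE 00; whether the (α)-socket's `(𝔖 k).μ` is this `gaussMeasure` is a NODE 00 pin question —
so this is NOT the IDENT at [Balaban1985UV3]'s (58) letters, NOT commissioned, NOT claimed.  The member rows of `M` (§4's hypotheses) are node N06's
content ([Balaban1985BackgroundPropagators] Sect. E: `γ₀` = G-B9-09, decay), DISPLAYED; print's cut-off `χ = Π_b χ(|A(b)| < p)` is a `𝔤`-norm ball per
bond, the road's box is per real coordinate — §4 states the coordinate box only.  Nothing of [Balaban1985UV3], [Balaban1984UV2], [BenfattoEtAl1978] or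
[Balaban1985BackgroundPropagators] is asserted or discharged; `PrintedUV3V` NOT proved; node N08 NOT discharged; nothing about d = 4, the continuum, OS
axioms, a mass gap or the Clay problem.
-/

noncomputable section

open MeasureTheory ProbabilityTheory Finset Matrix WithLp
open scoped ENNReal

namespace Literature.MathematicalPhysics.QuantumFieldTheory.Balaban1983to89.B10Eq55GaussianStepPresentation

open Literature.MathematicalPhysics.QuantumFieldTheory
open Literature.MathematicalPhysics.QuantumFieldTheory.Balaban1983to89.B1Eq324BenfattoLemma
open Literature.MathematicalPhysics.QuantumFieldTheory.Balaban1983to89.B1Eq324BenfattoClassAppendixC (posDef_of_coercive)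
open Literature.MathematicalPhysics.QuantumFieldTheory.Balaban1983to89.B1Eq324BenfattoClassPresentation (measurable_restrictAlong)
open Literature.MathematicalPhysics.QuantumFieldTheory.Balaban1983to89.B1Eq324BenfattoClassSectEMember (eq324_torus_of_expDecay_on_unit)
open Literature.MathematicalPhysics.QuantumFieldTheory.Balaban1983to89.B10Eq55GaussianStep (gaussMeasure Zk)

/-! ## §0  Two probability measures with proportional densities coincide (private plumbing) -/

/-- kernel: if `μ₁ = c₁·(f·ν)` and `μ₂ = c₂·(f·ν)` are both probability measures then `μ₁ = μ₂` (both constants equal `(∫f dν)⁻¹`). [folklore] -/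
private theorem eq_of_eq_smul_withDensity {α : Type*} [MeasurableSpace α] {ν μ₁ μ₂ : Measure α} {f : α → ℝ≥0∞}
    {c₁ c₂ : ℝ≥0∞} (h₁ : μ₁ = c₁ • ν.withDensity f) (h₂ : μ₂ = c₂ • ν.withDensity f)
    [IsProbabilityMeasure μ₁] [IsProbabilityMeasure μ₂] : μ₁ = μ₂ := by
  have hm : ∀ {c : ℝ≥0∞} {m : Measure α}, m = c • ν.withDensity f → IsProbabilityMeasure m →
      c = (ν.withDensity f Set.univ)⁻¹ := by
    intro c m hcm hprob
    have h := congrArg (fun m : Measure α => m Set.univ) hcm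
    simp only [measure_univ, Measure.smul_apply, smul_eq_mul] at h
    exact ENNReal.eq_inv_of_mul_eq_one_left h.symm
  rw [h₁, h₂, hm h₁ ‹_›, hm h₂ ‹_›]

/-! ## §1  On a finite index type the Gaussian field of a matrix kernel is Mathlib's multivariate Gaussian -/

section KernelVsMultivariate

variable {ι : Type*} [Fintype ι] [DecidableEq ι]

omit [Fintype ι] [DecidableEq ι] in
/-- A positive semidefinite matrix is a positive semidefinite kernel on its index type: every Gram matrix `covGram` is a principal submatrix.
[cite: Kallenberg2002, Lemma 13.1 (Gaussian fields from p.s.d. kernels; bookkeeping ours)] -/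
theorem isPosSemidefKernel_of_posSemidef {S : Matrix ι ι ℝ} (hS : S.PosSemidef) :
    IsPosSemidefKernel (fun i j : ι => S i j) := by
  intro I
  have h : covGram (fun i j : ι => S i j) I = S.submatrix (fun i : I => (i : ι)) (fun i : I => (i : ι)) := by
    ext s t
    rfl
  rw [h]
  exact hS.submatrix _

/-- ★★ **THE GAUSSIAN FIELD OF A MATRIX KERNEL ON A FINITE INDEX TYPE IS THE MULTIVARIATE GAUSSIAN** (read on `ι → ℝ`): for `S` positive
semidefinite, `gaussianFieldOfKernel (fun i j => S i j) = (multivariateGaussian 0 S).map ofLp` — by the tree's uniqueness theorem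
(`CurvatureGaussianField.eq_gaussianFieldOfKernel_of_isGaussianProcess`): under the right side the coordinate process is Gaussian (a continuous linear
image of a Gaussian measure), centred, with covariance `S i j` (Mathlib `covariance_eval_multivariateGaussian`).
[cite: Kallenberg2002, Lemma 13.1 (a centred Gaussian law is determined by its covariance)] -/
theorem gaussianFieldOfKernel_eq_map_multivariateGaussian {S : Matrix ι ι ℝ} (hS : S.PosSemidef) :
    gaussianFieldOfKernel (fun i j : ι => S i j) =
      (multivariateGaussian 0 S).map (MeasurableEquiv.toLp 2 (ι → ℝ)).symm := by
  set e := (MeasurableEquiv.toLp 2 (ι → ℝ)).symm with he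
  have hK := isPosSemidefKernel_of_posSemidef hS
  haveI : IsProbabilityMeasure ((multivariateGaussian 0 S).map e) :=
    Measure.isProbabilityMeasure_map e.measurable.aemeasurable
  symm
  refine eq_gaussianFieldOfKernel_of_isGaussianProcess hK ?_ ?_ ?_
  · -- the coordinate process is Gaussian: its finite-dimensional laws are continuous linear images of `multivariateGaussian 0 S`
    refine ⟨fun I => ⟨?_⟩⟩
    have hres : Measurable fun ω : ι → ℝ => I.restrict fun s : ι => ω s :=
      measurable_pi_lambda _ fun s => measurable_pi_apply _
    rw [Measure.map_map hres e.measurable]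
    let L : EuclideanSpace ℝ ι →L[ℝ] (↥I → ℝ) :=
      LinearMap.toContinuousLinearMap
        ((LinearMap.funLeft ℝ ℝ (fun i : I => (i : ι))) ∘ₗ (EuclideanSpace.equiv ι ℝ).toLinearEquiv.toLinearMap)
    have hL : ((fun ω : ι → ℝ => I.restrict fun s : ι => ω s) ∘ e) = ⇑L := by
      funext x
      funext i
      rfl
    rw [hL]
    infer_instance
  · -- centred
    intro s
    rw [integral_map_equiv]
    change ∫ x, (EuclideanSpace.proj s : EuclideanSpace ℝ ι →L[ℝ] ℝ) x ∂multivariateGaussian 0 S = 0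
    rw [(EuclideanSpace.proj s : EuclideanSpace ℝ ι →L[ℝ] ℝ).integral_comp_id_comm IsGaussian.integrable_id,
      integral_id_multivariateGaussian, map_zero]
  · -- covariance
    intro s t
    rw [covariance_map_equiv]
    exact covariance_eval_multivariateGaussian hS s t

end KernelVsMultivariate

/-! ## §2  On `ℝ^ι` with Lebesgue measure: lit-balaban's `gaussMeasure` of the form `⟨·, P·⟩` is the Gaussian field with covariance `P⁻¹` -/

section Coordinates

variable {ι : Type*} [Fintype ι] [DecidableEq ι]

/-- ★★ **`Z⁻¹·exp[−½vᵀPv]dv` IS THE CENTRED GAUSSIAN FIELD WITH COVARIANCE `P⁻¹`** — for a positive definite `P` on a finite index type, lit-balaban's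
`B10Eq55GaussianStep.gaussMeasure volume ⟨·, P·⟩` (the normalised Gaussian measure of the form, (3.155) at `g = 0` in coordinates — p.271 «the Gaussian
integral determined by the positive quadratic form») equals `gaussianFieldOfKernel (P⁻¹)`: Mathlib's `multivariateGaussian 0 P⁻¹` has density
`Z_P⁻¹e^{−½yᵀPy}` on Euclidean `ℝ^ι` (`GaussianToolkit.multivariateGaussian_inv_eq_withDensity`), the coordinate map is volume preserving, and two
probability measures with proportional densities coincide.
[cite: Balaban1985UV3, (55) p.269, p.271; Balaban1985BackgroundPropagators, (3.155)–(3.158) pp.427–428] -/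
theorem gaussMeasure_volume_eq_gaussianFieldOfKernel {P : Matrix ι ι ℝ} (hP : P.PosDef) :
    gaussMeasure (volume : Measure (ι → ℝ)) (Matrix.toLinearMap₂' ℝ P) =
      gaussianFieldOfKernel (fun i j : ι => (P⁻¹ : Matrix ι ι ℝ) i j) := by
  set e := (MeasurableEquiv.toLp 2 (ι → ℝ)).symm with he
  -- the common density on `ι → ℝ`
  set f : (ι → ℝ) → ℝ≥0∞ := fun v => ENNReal.ofReal (Real.exp (-(v ⬝ᵥ P *ᵥ v) / 2)) with hf
  obtain ⟨hmvG, -, hZtop⟩ := GaussianToolkit.multivariateGaussian_inv_eq_withDensity hP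
  have hvol : (volume : Measure (EuclideanSpace ℝ ι)).map e = volume :=
    (EuclideanSpace.volume_preserving_symm_measurableEquiv_toLp ι).map_eq
  have hfun : (GaussianToolkit.gaussWeight P ∘ ⇑e.symm) = f := by
    funext v
    rfl
  -- the right side as `Z_P⁻¹ · (f · dv)`
  have hR : gaussianFieldOfKernel (fun i j : ι => (P⁻¹ : Matrix ι ι ℝ) i j) =
      (GaussianToolkit.gaussZ P)⁻¹ • (volume : Measure (ι → ℝ)).withDensity f := by
    rw [gaussianFieldOfKernel_eq_map_multivariateGaussian hP.inv.posSemidef, ← he, hmvG, Measure.map_smul,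
      GaussianToolkit.map_withDensity_equiv, hvol, hfun]
  -- the left side as `(Zk)⁻¹ · (f · dv)`
  have hform : ∀ v : ι → ℝ, Matrix.toLinearMap₂' ℝ P v v = v ⬝ᵥ P *ᵥ v := fun v => Matrix.toLinearMap₂'_apply' P v v
  have hfg : (fun v : ι → ℝ => ENNReal.ofReal (B10Eq55GaussianStep.gaussWeight (Matrix.toLinearMap₂' ℝ P) v)) = f := by
    funext v
    simp only [hf, B10Eq55GaussianStep.gaussWeight, hform]
    congr 2
    ring
  have hL : gaussMeasure (volume : Measure (ι → ℝ)) (Matrix.toLinearMap₂' ℝ P) =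
      ENNReal.ofReal (Zk (volume : Measure (ι → ℝ)) (Matrix.toLinearMap₂' ℝ P))⁻¹ • (volume : Measure (ι → ℝ)).withDensity f := by
    rw [B10Eq55GaussianStep.gaussMeasure, hfg]
  -- both are probability measures
  haveI : IsProbabilityMeasure (gaussianFieldOfKernel (fun i j : ι => (P⁻¹ : Matrix ι ι ℝ) i j)) :=
    isProbabilityMeasure_gaussianFieldOfKernel (isPosSemidefKernel_of_posSemidef hP.inv.posSemidef)
  have hint : Integrable (B10Eq55GaussianStep.gaussWeight (Matrix.toLinearMap₂' ℝ P)) (volume : Measure (ι → ℝ)) := by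
    refine ⟨(B10Eq55GaussianStep.continuous_gaussWeight _).measurable.aestronglyMeasurable, ?_⟩
    rw [hasFiniteIntegral_iff_ofReal (Filter.Eventually.of_forall fun v => (B10Eq55GaussianStep.gaussWeight_pos _ v).le),
      hfg]
    have hZ : ∫⁻ v, f v ∂(volume : Measure (ι → ℝ)) = GaussianToolkit.gaussZ P := by
      rw [← hvol, lintegral_map_equiv]
      rfl
    rw [hZ]
    exact hZtop.lt_top
  haveI : IsProbabilityMeasure (gaussMeasure (volume : Measure (ι → ℝ)) (Matrix.toLinearMap₂' ℝ P)) :=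
    B10Eq55GaussianStep.isProbabilityMeasure_gaussMeasure volume _ hint
  exact eq_of_eq_smul_withDensity hL hR

end Coordinates

/-! ## §3  The abstract space of independent variables: `dμ_{C^{(k)}}` in the coordinates of any basis -/

section AbstractSpace

variable {S : Type*} [NormedAddCommGroup S] [NormedSpace ℝ S] [MeasurableSpace S] [BorelSpace S]
  (μ : Measure S) {ι : Type*} [Fintype ι] [DecidableEq ι]

/-- **`dμ_{C^{(k)}}` IN COORDINATES** — «we write the integral in terms of the independent variables Ã»: pushing lit-balaban's `gaussMeasure μ Δ` forward
along the coordinate map of a basis `b` gives the `gaussMeasure`, for the image Lebesgue measure, of the matrix form `⟨v, Mw⟩`, `M = LinearMap.toMatrix₂ b b Δ`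
(`B10Eq61GaussianLogarithm.apply_equivFun_symm`); the normalising constants `Z^{(k)}` agree.
[cite: Balaban1985UV3, p.271 (after (62)); Balaban1985BackgroundPropagators, (3.155) p.427] -/
theorem gaussMeasure_map_equivFun (b : Module.Basis ι ℝ S) (Δ : S →ₗ[ℝ] S →ₗ[ℝ] ℝ) :
    (gaussMeasure μ Δ).map ⇑b.equivFun =
      gaussMeasure (μ.map ⇑b.equivFun) (Matrix.toLinearMap₂' ℝ (LinearMap.toMatrix₂ b b Δ)) := by
  set Δ' : (ι → ℝ) →ₗ[ℝ] (ι → ℝ) →ₗ[ℝ] ℝ := Matrix.toLinearMap₂' ℝ (LinearMap.toMatrix₂ b b Δ) with hΔ'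
  set eM := b.equivFunL.toHomeomorph.toMeasurableEquiv with heM
  have hcoe : (⇑eM : S → ι → ℝ) = ⇑b.equivFun := rfl
  have hsymm : ∀ v, eM.symm v = b.equivFun.symm v := fun v => rfl
  have hform : ∀ v, B10Eq55GaussianStep.gaussWeight Δ (eM.symm v) = B10Eq55GaussianStep.gaussWeight Δ' v := by
    intro v
    simp only [B10Eq55GaussianStep.gaussWeight, hΔ', Matrix.toLinearMap₂'_apply', hsymm]
    rw [B10Eq61GaussianLogarithm.apply_equivFun_symm b Δ v v]
  rw [← hcoe]
  have hZ : Zk (μ.map ⇑eM) Δ' = Zk μ Δ := by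
    rw [B10Eq55GaussianStep.Zk, B10Eq55GaussianStep.Zk, integral_map_equiv]
    refine integral_congr_ae (Filter.Eventually.of_forall fun A => ?_)
    show B10Eq55GaussianStep.gaussWeight Δ' (eM A) = B10Eq55GaussianStep.gaussWeight Δ A
    rw [← hform (eM A), eM.symm_apply_apply]
  rw [B10Eq55GaussianStep.gaussMeasure, B10Eq55GaussianStep.gaussMeasure, hZ, Measure.map_smul,
    GaussianToolkit.map_withDensity_equiv]
  congr 2
  funext v
  change ENNReal.ofReal (B10Eq55GaussianStep.gaussWeight Δ (eM.symm v)) = ENNReal.ofReal (B10Eq55GaussianStep.gaussWeight Δ' v)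
  rw [hform v]

omit [MeasurableSpace S] [BorelSpace S] [DecidableEq ι] in
/-- **The coordinate box pulls back to the coordinate box**: `b.equivFun.symm ⁻¹' {A | ∀ i, |(b.equivFun A) i| ≤ p} = {ω | ∀ i, |ω i| ≤ p}` (the (α)-socket's
`hbox` letter for the presentation `b.equivFun.symm`; print's `χ = Π_b χ(|A(b)| < p)` read per real coordinate).
[cite: Balaban1985UV3, (51) p.268, (55) p.269 (the cut-off `χ`; coordinate reading ours)] -/
theorem preimage_box_eq (b : Module.Basis ι ℝ S) (p : ℝ) :
    ⇑b.equivFun.symm ⁻¹' {A : S | ∀ i, |b.equivFun A i| ≤ p} = {ω : ι → ℝ | ∀ i, |ω i| ≤ p} := by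
  ext ω
  simp only [Set.mem_preimage, Set.mem_setOf_eq, LinearEquiv.apply_symm_apply]

variable [μ.IsAddHaarMeasure]

/-- ★★★ **`dμ_{C^{(k)}}` IS THE CLASS FIELD IN EVERY BASIS** — for a Lebesgue measure `μ` of the space of independent variables (any normalisation), a basis
`b` and a form `Δ` whose matrix `M = LinearMap.toMatrix₂ b b Δ` (`M i j = Δ(b i, b j)`) is positive definite («the positive quadratic form
⟨A, C*Δ_kCA⟩»): `(gaussMeasure μ Δ).map b.equivFun = gaussianFieldOfKernel (M⁻¹)` — the image of `μ` is a multiple of Lebesgue measure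
(`B10Eq61GaussianLogarithm.exists_map_equivFunL_eq_smul`), the multiple cancels (`B10Eq55GaussianStep.gaussMeasure_smul_measure`), and §2.
[cite: Balaban1985UV3, (55) p.269, p.271; Balaban1985BackgroundPropagators, (3.155)–(3.158) pp.427–428] -/
theorem gaussMeasure_map_equivFun_eq_gaussianFieldOfKernel (b : Module.Basis ι ℝ S) (Δ : S →ₗ[ℝ] S →ₗ[ℝ] ℝ)
    (hM : (LinearMap.toMatrix₂ b b Δ).PosDef) :
    (gaussMeasure μ Δ).map ⇑b.equivFun =
      gaussianFieldOfKernel (fun i j : ι => ((LinearMap.toMatrix₂ b b Δ)⁻¹ : Matrix ι ι ℝ) i j) := by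
  obtain ⟨c, h0, htop, hc⟩ := B10Eq61GaussianLogarithm.exists_map_equivFunL_eq_smul μ b
  have hc' : μ.map ⇑b.equivFun = c • (volume : Measure (ι → ℝ)) := hc
  rw [gaussMeasure_map_equivFun μ b Δ, hc', B10Eq55GaussianStep.gaussMeasure_smul_measure (volume : Measure (ι → ℝ)) h0 htop,
    gaussMeasure_volume_eq_gaussianFieldOfKernel hM]

/-- ★★★ **THE PRESENTATION OF `dμ_{C^{(k)}}`** (the (α)-socket's `hμ` letter for this measure): with `M = LinearMap.toMatrix₂ b b Δ` positive definite,
`gaussMeasure μ Δ = (gaussianFieldOfKernel (M⁻¹)).map b.equivFun.symm` — the field of the free coordinates pushed forward by the inverse coordinate map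
(«They are connected with A by the simple linear operator C described there, A = CÃ»).
[cite: Balaban1985UV3, p.271; Balaban1985BackgroundPropagators, (3.158) p.428] -/
theorem gaussMeasure_eq_map_gaussianFieldOfKernel (b : Module.Basis ι ℝ S) (Δ : S →ₗ[ℝ] S →ₗ[ℝ] ℝ)
    (hM : (LinearMap.toMatrix₂ b b Δ).PosDef) :
    gaussMeasure μ Δ =
      (gaussianFieldOfKernel (fun i j : ι => ((LinearMap.toMatrix₂ b b Δ)⁻¹ : Matrix ι ι ℝ) i j)).map ⇑b.equivFun.symm := by
  have h := gaussMeasure_map_equivFun_eq_gaussianFieldOfKernel μ b Δ hM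
  set eM := b.equivFunL.toHomeomorph.toMeasurableEquiv with heM
  have hcoe : (⇑eM : S → ι → ℝ) = ⇑b.equivFun := rfl
  have hcoe' : (⇑eM.symm : (ι → ℝ) → S) = ⇑b.equivFun.symm := rfl
  rw [← hcoe', ← h, ← hcoe, MeasurableEquiv.map_symm_map]

omit [MeasurableSpace S] [BorelSpace S] [μ.IsAddHaarMeasure] in
/-- The matrix of a form in a basis is positive definite as soon as it is symmetric and `γ`-coercive for some `γ > 0` (the class road's member shape;
seat n08-b's `…ClassAppendixC.posDef_of_coercive`). [cite: Balaban1985BackgroundPropagators, p.428 («a positive definite operator C*Δ_kC with a lower bound γ₀ > 0»)] -/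
theorem posDef_toMatrix₂_of_coercive (b : Module.Basis ι ℝ S) (Δ : S →ₗ[ℝ] S →ₗ[ℝ] ℝ)
    (hMs : ∀ i j, LinearMap.toMatrix₂ b b Δ i j = LinearMap.toMatrix₂ b b Δ j i) {γ : ℝ} (hγ0 : 0 < γ)
    (hγ : ∀ v : ι → ℝ, γ * ∑ i, v i ^ 2 ≤ ∑ i, ∑ j, LinearMap.toMatrix₂ b b Δ i j * v i * v j) :
    (LinearMap.toMatrix₂ b b Δ).PosDef :=
  posDef_of_coercive hMs hγ0 hγ

end AbstractSpace

/-! ## §4  [Balaban1982Higgs1] (3.24) for lit-balaban's `dμ_{C^{(k)}}` on a labelled torus block, every `η ∈ (0,1]` -/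

section Torus

variable {d : ℕ}

/-- ★★★ **(3.24) FOR `dμ_{C^{(k)}}` AS TYPED BY CELL LIT-BALABAN, ON A TORUS BLOCK, AT EVERY COUPLING `η ∈ (0,1]`.**  Class scalars FIRST: `d ≥ 1`, label
count `m`, `γ > 0`, `K ≥ 0`, `κ_T > 0`, and the (3.24) letters `t D`, `ϰ > 0`, `p₀ > 2/3`, `σ > 0`, `c ≥ 0`, `0 < κ < σ(t+1)`.  THEN `∃ b₁ ∀ b₀ > b₁ ∃ C ≥ 0`
such that for EVERY `η ∈ (0,1]`, torus size `N`, variables `β ≠ ∅` with torus sites `site` and labels `lab` (jointly injective), EVERY finite-dimensional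
space `S` of independent variables with a Lebesgue measure `μ` (any normalisation), basis `b : Module.Basis β ℝ S` and form `Δ` whose matrix `M = toMatrix₂ b b Δ`
is symmetric, `γ`-coercive and decays like `K e^{−κ_Tρ}` for a `ρ` dominating the torus sup-distance of the sites: a window `Λ ⊂ ℤ^{2d+1}`, `e : β ≃ ↥Λ`
with the PRESENTATION `gaussMeasure μ Δ = (μ_K).map (b.equivFun.symm ∘ (z ↦ z ∘ e))` (`K` = zero-extended `(reindex e e M)⁻¹`), the a.e. identity of
the coordinate boxes `{A : ∀ b, |(b.equivFun A) b| ≤ p}` with `smallFieldSet Λ p`, and for all `(s, I ⊇ J, a)` with `I ≠ ∅`, `J ⊆ Λ`, `sup|a| ≤ c·η^σ`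
the (3.24) pair for `μ_K`.  Proof: §3 + seat n08-b's `eq324_torus_of_expDecay_on_unit`.
[cite: Balaban1985UV3, (55) p.269, (58) p.270, p.271; Balaban1982Higgs1, (3.24) p.616; BenfattoEtAl1978, Lemma (4.5)–(4.7) p.152;
Balaban1985BackgroundPropagators, (3.155)–(3.158) pp.427–428 (class form; the bent window is ours)] -/
theorem eq324_gaussMeasure_torus_on_unit (hd : 0 < d) (m : ℕ) {γ K κT : ℝ} (hγ0 : 0 < γ) (hK : 0 ≤ K) (hκT : 0 < κT)
    (t D : ℕ) {ϰ : ℝ} (hϰ : 0 < ϰ) {p₀ σ c κ : ℝ} (hp₀ : 2 / 3 < p₀) (hσ : 0 < σ) (hc : 0 ≤ c) (hκ : 0 < κ)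
    (hκσ : κ < σ * (t + 1)) :
    ∃ b₁ : ℝ, ∀ b₀ : ℝ, b₁ < b₀ → ∃ C : ℝ, 0 ≤ C ∧ ∀ η : ℝ, 0 < η → η ≤ 1 →
      ∀ {N : ℕ} [NeZero N] {β : Type} [Fintype β] [DecidableEq β] [Nonempty β]
        (site : β → Fin d → ZMod N) (lab : β → Fin m), (Function.Injective fun b => (site b, lab b)) →
      ∀ {S : Type} [NormedAddCommGroup S] [NormedSpace ℝ S] [MeasurableSpace S] [BorelSpace S]
        (μ : Measure S) [μ.IsAddHaarMeasure] (bs : Module.Basis β ℝ S) (Δ : S →ₗ[ℝ] S →ₗ[ℝ] ℝ) {ρ : β → β → ℝ},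
        (∀ b b', LinearMap.toMatrix₂ bs bs Δ b b' = LinearMap.toMatrix₂ bs bs Δ b' b) →
        (∀ v : β → ℝ, γ * ∑ b, v b ^ 2 ≤ ∑ b, ∑ b', LinearMap.toMatrix₂ bs bs Δ b b' * v b * v b') →
        (∀ b b', |LinearMap.toMatrix₂ bs bs Δ b b'| ≤ K * Real.exp (-(κT * ρ b b'))) →
        (∀ b b' i, (|((site b i - site b' i).valMinAbs : ℤ)| : ℝ) ≤ ρ b b') →
      ∃ (Λ : Finset (B1Eq324BenfattoLemma.Site (d + d + 1))) (e : β ≃ ↥Λ),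
        gaussMeasure μ Δ =
          (gaussianFieldOfKernel fun x y => if h : x ∈ Λ ∧ y ∈ Λ then
              ((Matrix.reindex e e (LinearMap.toMatrix₂ bs bs Δ))⁻¹ : Matrix ↥Λ ↥Λ ℝ) ⟨x, h.1⟩ ⟨y, h.2⟩ else 0).map
            (fun (z : B1Eq324BenfattoLemma.Site (d + d + 1) → ℝ) => bs.equivFun.symm fun b : β => z ((e b : ↥Λ) : B1Eq324BenfattoLemma.Site (d + d + 1))) ∧
        (∀ p : ℝ, 0 ≤ p →
          ((fun (z : B1Eq324BenfattoLemma.Site (d + d + 1) → ℝ) => bs.equivFun.symm fun b : β => z ((e b : ↥Λ) : B1Eq324BenfattoLemma.Site (d + d + 1))) ⁻¹'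
              {A : S | ∀ b : β, |bs.equivFun A b| ≤ p}) =ᵐ[gaussianFieldOfKernel fun x y => if h : x ∈ Λ ∧ y ∈ Λ then
                ((Matrix.reindex e e (LinearMap.toMatrix₂ bs bs Δ))⁻¹ : Matrix ↥Λ ↥Λ ℝ) ⟨x, h.1⟩ ⟨y, h.2⟩ else 0] smallFieldSet Λ p) ∧
        ∀ (s : ℕ) (I J : Finset (B1Eq324BenfattoLemma.Site (d + d + 1))) (a : Coef (d + d + 1)), I.Nonempty → J ⊆ I → J ⊆ Λ →
          coefSup s D a J ≤ c * η ^ σ →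
          0 < ∫ z, cutoffBoltzmann (hamiltonian s D ϰ a J) I (B10.pFun b₀ p₀ η) z ∂(gaussianFieldOfKernel fun x y =>
              if h : x ∈ Λ ∧ y ∈ Λ then ((Matrix.reindex e e (LinearMap.toMatrix₂ bs bs Δ))⁻¹ : Matrix ↥Λ ↥Λ ℝ) ⟨x, h.1⟩ ⟨y, h.2⟩ else 0) ∧
            |Real.log (∫ z, cutoffBoltzmann (hamiltonian s D ϰ a J) I (B10.pFun b₀ p₀ η) z ∂(gaussianFieldOfKernel fun x y =>
                if h : x ∈ Λ ∧ y ∈ Λ then ((Matrix.reindex e e (LinearMap.toMatrix₂ bs bs Δ))⁻¹ : Matrix ↥Λ ↥Λ ℝ) ⟨x, h.1⟩ ⟨y, h.2⟩ else 0)) -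
              cumulantSum (gaussianFieldOfKernel fun x y =>
                if h : x ∈ Λ ∧ y ∈ Λ then ((Matrix.reindex e e (LinearMap.toMatrix₂ bs bs Δ))⁻¹ : Matrix ↥Λ ↥Λ ℝ) ⟨x, h.1⟩ ⟨y, h.2⟩ else 0)
                (hamiltonian s D ϰ a J) t| ≤ C * η ^ κ * I.card := by
  obtain ⟨b₁, hb₁⟩ := eq324_torus_of_expDecay_on_unit (d := d) hd m hγ0 hK hκT t D hϰ hp₀ hσ hc hκ hκσ
  refine ⟨b₁, fun b₀ hb₀ => ?_⟩
  obtain ⟨C, hC, hE⟩ := hb₁ b₀ hb₀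
  refine ⟨C, hC, fun η hη hηle N _ β _ _ _ site lab hinj S _ _ _ _ μ _ bs Δ ρ hTs hγ hdec hρ => ?_⟩
  obtain ⟨Λ, e, hmap, hbox, h324⟩ := hE η hη hηle site lab hinj hTs hγ hdec hρ
  have hM : (LinearMap.toMatrix₂ bs bs Δ).PosDef := posDef_of_coercive hTs hγ0 hγ
  have hsym : Measurable (⇑bs.equivFun.symm : (β → ℝ) → S) := bs.equivFunL.symm.continuous.measurable
  have hrA : Measurable fun (z : B1Eq324BenfattoLemma.Site (d + d + 1) → ℝ) (b : β) => z ((e b : ↥Λ) : B1Eq324BenfattoLemma.Site (d + d + 1)) :=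
    measurable_restrictAlong e
  refine ⟨Λ, e, ?_, fun p hp => ?_, h324⟩
  · rw [gaussMeasure_eq_map_gaussianFieldOfKernel μ bs Δ hM, ← hmap, Measure.map_map hsym hrA]
    rfl
  · have hset : ((fun (z : B1Eq324BenfattoLemma.Site (d + d + 1) → ℝ) => bs.equivFun.symm fun b : β =>
          z ((e b : ↥Λ) : B1Eq324BenfattoLemma.Site (d + d + 1))) ⁻¹' {A : S | ∀ b : β, |bs.equivFun A b| ≤ p}) =
        (fun (z : B1Eq324BenfattoLemma.Site (d + d + 1) → ℝ) (b : β) => z ((e b : ↥Λ) : B1Eq324BenfattoLemma.Site (d + d + 1))) ⁻¹'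
          {ω : β → ℝ | ∀ b, |ω b| ≤ p} := by
      ext z
      simp only [Set.mem_preimage, Set.mem_setOf_eq, LinearEquiv.apply_symm_apply]
    rw [hset]
    exact hbox p hp

/-- Non-vacuity of the scalar side of `eq324_gaussMeasure_torus_on_unit` (the binder list elaborates end to end): `d = 3`, label count `m = 24`
(3 bond directions × 8 colours of `su(3)`), `γ = 1`, `K = 2`, `κ_T = 1/3`, and the (α)-socket's letters `t = 6`, `D = 4`, `ϰ = 1`, `p₀ = 1`, `σ = 1/2`,
`c = 1`, `κ = 13/4 < σ(t+1)`. [cite: Balaban1985UV3, (58) p.270 (letters of the socket; instance ours)] -/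
example :=
  eq324_gaussMeasure_torus_on_unit (d := 3) (by norm_num) 24 (γ := 1) (K := 2) (κT := 1 / 3) one_pos (by norm_num) (by norm_num)
    6 4 (ϰ := 1) one_pos (p₀ := 1) (σ := 1 / 2) (c := 1) (κ := 13 / 4) (by norm_num) (by norm_num) zero_le_one (by norm_num) (by norm_num)

end Torus

end Literature.MathematicalPhysics.QuantumFieldTheory.Balaban1983to89.B10Eq55GaussianStepPresentation

end
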